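import Mathlib
import HarnessLib
import Literature.Analysis.Convex.FenchelConjugate
import Literature.Analysis.Convex.RelativeInteriorConvexSets
import Literature.Analysis.Convex.RelativeInteriorOperations
import Literature.Analysis.Convex.ProperSeparation
import Literature.Analysis.Convex.DualOperations

/-!
# Fenchel duality, conjugates of sums and subdifferential calculus under Rockafellar's
# relative-interior qualification (Rockafellar 1970: Thm 31.1 (a), Cor 31.2.1 (a), Thms 16.3–16.4,
# Cors 16.3.1, 16.4.1, 16.4.2, Thms 23.8–23.9, Cor 23.8.1, Thm 27.4)

Rockafellar, *Convex Analysis* (1970).  The sibling anchors `ConvexSandwichTheorem` (Borwein–Zhu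
§4.3), `DualOperations` (§16) and `FenchelConjugate` (§4.4 of Borwein–Zhu) prove Fenchel duality,
the attained infimal-convolution formula `(f + gA)* = min {f*(· − A*y*) + g*(y*)}`, the
subdifferential sum rule and the normal cone to an intersection in an arbitrary normed space under
the INTERIOR-POINT qualification «`dom g` is a neighbourhood of some `Ax₀`, `x₀ ∈ dom f`, at which
`g` is continuous» (Borwein–Zhu (4.3.2)).  Rockafellar's finite-dimensional statements use the
weaker and, for the flat feasible sets of conic programming, decisive RELATIVE-INTERIOR
qualification

  «there is `x ∈ ri (dom f)` with `Ax ∈ ri (dom g)`»  (for `A = I`: `ri (dom f) ∩ ri (dom g) ≠ ∅`),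

condition (a) of Theorem 31.1 / Corollary 31.2.1 and the hypothesis of Theorems 16.3, 16.4, 23.8,
23.9 and 27.4.  This file proves all of these statements under that qualification, for
finite-dimensional real normed spaces `V`, `W`, over Mathlib's `intrinsicInterior ℝ` and the tree's
relative-interior calculus (`RelativeInteriorConvexSets`, §6; `RelativeInteriorOperations`, §6;
`ProperSeparation`, §11).  Everything is proved; no new definitions.

## The engine

`decoupling_of_intrinsicInterior`: if `p ≤ f(x) + g(Ax)` on the feasible set, some `y*` has
`p ≤ [f(x) − ⟨Ax, y*⟩] + [g(y) + ⟨y, y*⟩]` for all `x ∈ dom f`, `y ∈ dom g`.  Proof (a direct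
separation argument replacing the book's route through the closure formula of Thm 16.4): in
`W × ℝ` the convex sets `S₁ = {(Ax, μ) | μ ≥ f(x)}` and `S₂ = {(y, ν) | y ∈ dom g, ν ≤ p − g(y)}`
have disjoint relative interiors (a point of `ri S₂` lies strictly below the graph of `p − g`,
Thm 6.4), so Thm 11.3 (`ProperSeparation.exists_properSeparation_iff_disjoint_intrinsicInterior`)
separates them properly by some `(y*, t)`; `t ≥ 0` because `S₁` is closed upwards; `t = 0` would
make `y*` separate `A dom f` and `dom g` properly, which by Thm 11.3 again contradicts
`Ax ∈ ri (A dom f) ∩ ri (dom g)` (`ri (A dom f) = A ri (dom f)`, Thm 6.6,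
`RelativeInteriorOperations.intrinsicInterior_image`); so `t > 0` and `−y*/t` decouples.

## Encoding (declared deviations from the printed text)

* As in the siblings: a proper convex function is a pair (`D` = `dom f`, real `f` with
  `ConvexOn ℝ D f`), `x*` is `xs : V →L[ℝ] ℝ`, `f*` is `fenchelConj D f`, `δ*(· | C)` is
  `supportFun C`, `A*y* = y*.comp A`; `gA` has domain `A⁻¹ dom g`, `f + g` has domain
  `dom f ∩ dom g`; the book's concave `g` of §31 is replaced by the convex `−g`, so Thm 31.1 reads
  `inf {f + g} = max {−f*(x*) − g*(−x*)}` (the transcription `g_*(x*) = −(−g)*(−x*)` is on p. 308).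
  Closedness of `f`, `g` (assumed in Cor 31.2.1) is not needed under condition (a) and not assumed.
* `ri` is `intrinsicInterior ℝ`; `V`, `W` are finite-dimensional (this is used through Thms 6.4,
  6.6 and 11.3).
* Subgradients and normal vectors are written out: `x* ∈ ∂f(x̄)` is
  `∀ y ∈ dom f, x*(y − x̄) ≤ f(y) − f(x̄)`; `x*` normal to `C` at `x̄` is `∀ c ∈ C, x*(c − x̄) ≤ 0`.
* NOT formalised: conditions (b) of Thm 31.1 / Cor 31.2.1 (the closed case with the qualification
  on the dual side), the polyhedral refinements (Thm 31.1 last paragraph, Thm 23.8 last sentence,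
  Thm 23.9 and Thm 27.4 polyhedral clauses, §20), and the `m`-fold versions (stated for `m = 2`).

## Main statements (all proved; no named facts, no `sorry`)

* `decoupling_of_intrinsicInterior` — the decoupling lemma under the `ri` qualification.
* `fenchel_duality_of_intrinsicInterior` — Cor 31.2.1 (a): `inf {f + gA} = max {−f*A* − g*(−·)}`.
* `iInf_add_eq_iSup_of_intrinsicInterior` — Thm 31.1 (a) (`A = I`).
* `exists_fenchelConj_add_comp_eq_of_intrinsicInterior` — Thms 16.3/16.4:
  `(f + gA)*(x*) = min_{y*} {f*(x* − A*y*) + g*(y*)}`.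
* `exists_fenchelConj_add_eq_of_intrinsicInterior` — Thm 16.4: `(f₁ + f₂)* = f₁* □ f₂*`, attained.
* `exists_fenchelConj_comp_eq_of_intrinsicInterior` — Thm 16.3:
  `(gA)*(x*) = min {g*(y*) | A*y* = x*}`.
* `exists_supportFun_preimage_eq_of_intrinsicInterior` — Cor 16.3.1:
  `δ*(x* | A⁻¹D) = min {δ*(y* | D) | A*y* = x*}`.
* `exists_supportFun_inter_eq_of_intrinsicInterior` — Cor 16.4.1:
  `δ*(· | C₁ ∩ C₂) = δ*(· | C₁) □ δ*(· | C₂)`, attained.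
* `subdiff_sum_rule_of_intrinsicInterior` — Thms 23.8/23.9: `∂(f + gA)(x̄) = ∂f(x̄) + A*∂g(Ax̄)`.
* `normalCone_inter_of_intrinsicInterior` — Cor 23.8.1: `N(C₁ ∩ C₂; x̄) = N(C₁; x̄) + N(C₂; x̄)`.
* `negPolarCone_inter_of_intrinsicInterior` — Cor 16.4.2: `(K₁ ∩ K₂)° = K₁° + K₂°`.
* `isMinOn_iff_exists_subgradient_of_intrinsicInterior` — Thm 27.4 (Pshenichnyi–Rockafellar).

## References

* R. T. Rockafellar, *Convex Analysis*, Princeton University Press 1970: §31 Thm 31.1 p. 327,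
  Cor 31.2.1 p. 332; §16 Thms 16.3–16.4 and Cors 16.3.1, 16.4.1, 16.4.2, pp. 142–146; §23
  Thms 23.8–23.9 and Cor 23.8.1, pp. 223–225; §27 Thm 27.4 p. 270 (held copy
  `book:rockafellarnd-convex-analysis`, chunks p0282–p0286, p0129–p0132, p0195–p0197, p0235).
  Key `Rockafellar1970`.
-/

open Set
open scoped Pointwise
open Literature.Analysis.Convex.RelativeInteriorConvexSets
open Literature.Analysis.Convex.RelativeInteriorOperations
open Literature.Analysis.Convex.ProperSeparation
open Literature.Analysis.Convex.FenchelConjugate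
open Literature.Analysis.Convex.SupportFunction
open Literature.Analysis.Convex.DualOperations (fenchelConj_add_comp_le fenchelConj_add_le
  fenchelConj_zero_univ_zero fenchelConj_zero_univ_of_ne_zero)

namespace Literature.Analysis.Convex.RelativeInteriorQualification

variable {V W : Type*} [NormedAddCommGroup V] [NormedSpace ℝ V] [FiniteDimensional ℝ V]
  [NormedAddCommGroup W] [NormedSpace ℝ W] [FiniteDimensional ℝ W]
variable {Df : Set V} {Dg : Set W} {f : V → ℝ} {g : W → ℝ} {x₀ : V}

omit [FiniteDimensional ℝ W] in
/-- A continuous linear functional on `W × ℝ` splits as `φ(y, μ) = φ(y, 0) + μ φ(0, 1)`.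
[folklore] -/
private theorem apply_prod_eq (φ : W × ℝ →L[ℝ] ℝ) (y : W) (μ : ℝ) :
    φ (y, μ) = φ (y, 0) + μ * φ (0, 1) := by
  have h : ((y, μ) : W × ℝ) = (y, 0) + μ • ((0 : W), (1 : ℝ)) := by ext <;> simp
  rw [h, map_add, map_smul, smul_eq_mul]

/-- **The decoupling lemma under Rockafellar's relative-interior qualification** (the engine of
Thm 31.1 / Cor 31.2.1 under condition (a)): `V`, `W` finite-dimensional, `f` convex on `dom f`,
`g` convex on `dom g`, `A` linear, and SOME `x ∈ ri (dom f)` HAS `Ax ∈ ri (dom g)`; if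
`p ≤ f(x) + g(Ax)` whenever `x ∈ dom f`, `Ax ∈ dom g`, then some `y* ∈ W*` decouples:
`p ≤ [f(x) − ⟨Ax, y*⟩] + [g(y) + ⟨y, y*⟩]` for all `x ∈ dom f`, `y ∈ dom g`.  (Proof by PROPER
separation, Thm 11.3, of `(A × 1)(epi f)` from the reflected hypograph `{(y, ν) | ν ≤ p − g(y)}`
in `W × ℝ`: their relative interiors are disjoint, a properly separating functional `(y*, t)` has
`t ≥ 0`, and `t = 0` would separate `A dom f` from `dom g` properly, which Thm 11.3 and
`ri (A dom f) = A ri (dom f)` (Thm 6.6) forbid under the qualification.)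
[cite: Rockafellar1970, §31 Thm 31.1 (a) p. 327 and Cor 31.2.1 (a) p. 332 (held chunks
p0282–p0285), proof organised through §11 Thm 11.3 instead of §16 Thm 16.4] -/
theorem decoupling_of_intrinsicInterior (hf : ConvexOn ℝ Df f) (hg : ConvexOn ℝ Dg g)
    (A : V →L[ℝ] W) (hx₀ : x₀ ∈ intrinsicInterior ℝ Df)
    (hAx₀ : A x₀ ∈ intrinsicInterior ℝ Dg) {p : ℝ} (hp : ∀ x ∈ Df, A x ∈ Dg → p ≤ f x + g (A x)) :
    ∃ ys : W →L[ℝ] ℝ, ∀ x ∈ Df, ∀ y ∈ Dg, p ≤ (f x - ys (A x)) + (g y + ys y) := by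
  have hx₀D : x₀ ∈ Df := intrinsicInterior_subset hx₀
  have hAx₀D : A x₀ ∈ Dg := intrinsicInterior_subset hAx₀
  -- the two convex sets of `W × ℝ`
  set S₁ : Set (W × ℝ) := {s | ∃ x ∈ Df, A x = s.1 ∧ f x ≤ s.2} with hS₁
  set S₂ : Set (W × ℝ) := {s | s.1 ∈ Dg ∧ s.2 ≤ p - g s.1} with hS₂
  have hS₁c : Convex ℝ S₁ := by
    rintro s ⟨x, hx, hAx, hfx⟩ s' ⟨x', hx', hAx', hfx'⟩ a b ha hb hab
    refine ⟨a • x + b • x', hf.1 hx hx' ha hb hab, ?_, ?_⟩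
    · simp [hAx, hAx']
    · have h := hf.2 hx hx' ha hb hab
      simp only [smul_eq_mul, Prod.snd_add, Prod.smul_snd] at h ⊢
      nlinarith
  have hS₂c : Convex ℝ S₂ := by
    rintro s ⟨hs, hsle⟩ s' ⟨hs', hsle'⟩ a b ha hb hab
    refine ⟨hg.1 hs hs' ha hb hab, ?_⟩
    have h := hg.2 hs hs' ha hb hab
    simp only [smul_eq_mul, Prod.snd_add, Prod.smul_snd, Prod.fst_add, Prod.smul_fst] at h ⊢
    have : a * p + b * p = p := by rw [← add_mul, hab, one_mul]
    nlinarith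
  have hS₁ne : S₁.Nonempty := ⟨(A x₀, f x₀), x₀, hx₀D, rfl, le_rfl⟩
  have hS₂ne : S₂.Nonempty := ⟨(A x₀, p - g (A x₀)), hAx₀D, le_rfl⟩
  -- their relative interiors are disjoint: a point of `ri S₂` lies STRICTLY below `p − g`
  have hdisj : Disjoint (intrinsicInterior ℝ S₁) (intrinsicInterior ℝ S₂) := by
    rw [disjoint_left]
    intro s hs₁ hs₂
    obtain ⟨x, hx, hAx, hfx⟩ := (intrinsicInterior_subset hs₁ : s ∈ S₁)
    have hsS₂ : s ∈ S₂ := intrinsicInterior_subset hs₂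
    have hbelow : ((s.1, s.2 - 1) : W × ℝ) ∈ S₂ := ⟨hsS₂.1, by linarith [hsS₂.2]⟩
    obtain ⟨μ, hμ1, hmem⟩ := exists_one_lt_combo_mem hs₂ hbelow
    have h2 : ((1 - μ) • ((s.1, s.2 - 1) : W × ℝ) + μ • s).2 = s.2 + (μ - 1) := by
      simp only [Prod.snd_add, Prod.smul_snd, smul_eq_mul]; ring
    have h1 : ((1 - μ) • ((s.1, s.2 - 1) : W × ℝ) + μ • s).1 = s.1 := by
      simp only [Prod.fst_add, Prod.smul_fst]
      rw [← add_smul, sub_add_cancel, one_smul]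
    have hlt : s.2 < p - g s.1 := by
      have := hmem.2
      rw [h2, h1] at this
      linarith
    have hAxD : A x ∈ Dg := by rw [hAx]; exact hsS₂.1
    have := hp x hx hAxD
    rw [hAx] at this
    linarith
  -- proper separation (Thm 11.3)
  obtain ⟨φ, hle, s₁, hs₁, s₂, hs₂, hlt⟩ :=
    (exists_properSeparation_iff_disjoint_intrinsicInterior hS₁c hS₂c hS₁ne hS₂ne).2 hdisj
  set t : ℝ := φ (0, 1) with ht
  set ys₀ : W →L[ℝ] ℝ := φ.comp (ContinuousLinearMap.inl ℝ W ℝ) with hys₀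
  have hφ : ∀ (y : W) (μ : ℝ), φ (y, μ) = ys₀ y + μ * t := fun y μ => by
    rw [apply_prod_eq φ y μ, ← ht]
    simp [hys₀]
  -- `t ≥ 0`: `S₁` is closed upwards
  have ht0 : 0 ≤ t := by
    by_contra hneg
    push Not at hneg
    set K : ℝ := ys₀ (A x₀) + f x₀ * t - φ (A x₀, p - g (A x₀)) with hK
    have hm : ∀ m : ℝ, 0 ≤ m → m * -t ≤ K := fun m hm => by
      have h' := hle (A x₀, f x₀ + m) ⟨x₀, hx₀D, rfl, by simp [hm]⟩ (A x₀, p - g (A x₀))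
        ⟨hAx₀D, le_rfl⟩
      rw [hφ (A x₀) (f x₀ + m)] at h'
      have e : (f x₀ + m) * t = f x₀ * t + m * t := by ring
      rw [e] at h'
      rw [hK]
      linarith
    have h := hm ((|K| + 1) / -t) (div_nonneg (by positivity) (by linarith))
    rw [div_mul_cancel₀ _ (by linarith : -t ≠ 0)] at h
    linarith [le_abs_self K]
  rcases ht0.eq_or_lt with ht00 | htpos
  · -- `t = 0`: `ys₀` separates `A dom f` and `dom g` properly — impossible under the CQ
    exfalso
    have hsep : (∀ a ∈ (A : V → W) '' Df, ∀ b ∈ Dg, ys₀ b ≤ ys₀ a) ∧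
        ∃ a ∈ (A : V → W) '' Df, ∃ b ∈ Dg, ys₀ b < ys₀ a := by
      refine ⟨?_, ?_⟩
      · rintro _ ⟨x, hx, rfl⟩ b hb
        have h := hle (A x, f x) ⟨x, hx, rfl, le_rfl⟩ (b, p - g b) ⟨hb, le_rfl⟩
        rwa [hφ, hφ, ← ht00, mul_zero, mul_zero, add_zero, add_zero] at h
      · obtain ⟨x₁, hx₁, hAx₁, -⟩ := hs₁
        refine ⟨s₁.1, ⟨x₁, hx₁, hAx₁⟩, s₂.1, hs₂.1, ?_⟩
        have e₁ : φ s₁ = ys₀ s₁.1 := by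
          rw [← Prod.mk.eta (p := s₁), hφ, ← ht00, mul_zero, add_zero]
        have e₂ : φ s₂ = ys₀ s₂.1 := by
          rw [← Prod.mk.eta (p := s₂), hφ, ← ht00, mul_zero, add_zero]
        rw [← e₁, ← e₂]; exact hlt
    have hADc : Convex ℝ ((A : V → W) '' Df) := by
      simpa using hf.1.linear_image (A : V →ₗ[ℝ] W)
    have hADne : ((A : V → W) '' Df).Nonempty := ⟨A x₀, x₀, hx₀D, rfl⟩
    have hdisj' := (exists_properSeparation_iff_disjoint_intrinsicInterior hADc hg.1 hADne
      ⟨A x₀, hAx₀D⟩).1 ⟨ys₀, hsep.1, hsep.2⟩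
    have himg : intrinsicInterior ℝ ((A : V → W) '' Df) =
        (A : V → W) '' intrinsicInterior ℝ Df := by
      have := intrinsicInterior_image ((A : V →ₗ[ℝ] W).toAffineMap) hf.1
      simpa using this
    have hmem : A x₀ ∈ intrinsicInterior ℝ ((A : V → W) '' Df) := by
      rw [himg]; exact ⟨x₀, hx₀, rfl⟩
    exact disjoint_left.1 hdisj' hmem hAx₀
  · -- `t > 0`: normalise and read off the decoupling
    refine ⟨-(t⁻¹ • ys₀), fun x hx y hy => ?_⟩
    have h := hle (A x, f x) ⟨x, hx, rfl, le_rfl⟩ (y, p - g y) ⟨hy, le_rfl⟩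
    rw [hφ, hφ] at h
    have e1 : (-(t⁻¹ • ys₀)) (A x) = -(t⁻¹ * ys₀ (A x)) := rfl
    have e2 : (-(t⁻¹ • ys₀)) y = -(t⁻¹ * ys₀ y) := rfl
    rw [e1, e2]
    -- divide `ys₀ y + (p − g y) t ≤ ys₀ (A x) + f x · t` by `t`
    have h2 : t * (p - f x - g y) ≤ ys₀ (A x) - ys₀ y := by nlinarith
    have key : p - f x - g y ≤ t⁻¹ * (ys₀ (A x) - ys₀ y) := by
      have := mul_le_mul_of_nonneg_left h2 (inv_nonneg.2 htpos.le)
      rwa [inv_mul_cancel_left₀ htpos.ne'] at this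
    rw [mul_sub] at key
    linarith

/-! ## §31: Fenchel's duality theorem under condition (a) -/

omit [FiniteDimensional ℝ V] [FiniteDimensional ℝ W] in
/-- The primal value is the greatest lower bound of the primal objective values whenever it is
not `−∞` and the feasible set is non-empty. [folklore] -/
private theorem isGLB_of_fenchelPrimalValue_ne_bot (A : V →L[ℝ] W) (hx₀ : x₀ ∈ Df)
    (hAx₀ : A x₀ ∈ Dg) (hbot : fenchelPrimalValue Df f Dg g A ≠ ⊥) :
    fenchelPrimalValue Df f Dg g A = (((fenchelPrimalValue Df f Dg g A).toReal : ℝ) : EReal) ∧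
      IsGLB ((fun x => f x + g (A x)) '' {x ∈ Df | A x ∈ Dg})
        (fenchelPrimalValue Df f Dg g A).toReal := by
  have hle : ∀ x ∈ {x ∈ Df | A x ∈ Dg},
      fenchelPrimalValue Df f Dg g A ≤ ((f x + g (A x) : ℝ) : EReal) := fun x hx =>
    iInf₂_le (f := fun x (_ : x ∈ {x ∈ Df | A x ∈ Dg}) => ((f x + g (A x) : ℝ) : EReal)) x hx
  have htop : fenchelPrimalValue Df f Dg g A ≠ ⊤ :=
    ne_top_of_le_ne_top (EReal.coe_ne_top _) (hle x₀ ⟨hx₀, hAx₀⟩)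
  have heq : fenchelPrimalValue Df f Dg g A =
      (((fenchelPrimalValue Df f Dg g A).toReal : ℝ) : EReal) := (EReal.coe_toReal htop hbot).symm
  refine ⟨heq, ?_, ?_⟩
  · rintro _ ⟨x, hx, rfl⟩
    have h := hle x hx
    rw [heq, EReal.coe_le_coe_iff] at h
    exact h
  · intro b hb
    have h : (b : EReal) ≤ fenchelPrimalValue Df f Dg g A :=
      le_iInf₂ fun x hx => EReal.coe_le_coe_iff.2 (hb ⟨x, hx, rfl⟩)
    rw [heq, EReal.coe_le_coe_iff] at h
    exact h

/-- **Corollary 31.2.1 under condition (a) — Fenchel's duality theorem with a linear map, in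
Rockafellar's own finite-dimensional form:** if `f` is convex on `dom f ⊆ V`, `g` is convex on
`dom g ⊆ W` (`V`, `W` finite-dimensional) and some `x ∈ ri (dom f)` has `Ax ∈ ri (dom g)`, then
`inf_x {f(x) + g(Ax)} = sup_{y*} {−f*(A*y*) − g*(−y*)}` and the supremum is attained.  (The book
states it for `f` convex and `g` concave as `inf {f − gA} = sup {g_* − f*A*}`; with `g ↦ −g` and
`g_*(y*) = −(−g)*(−y*)` this is the same formula.)
[cite: Rockafellar1970, §31 Cor 31.2.1 (a) p. 332 (held chunks p0285–p0286)] -/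
theorem fenchel_duality_of_intrinsicInterior (hf : ConvexOn ℝ Df f) (hg : ConvexOn ℝ Dg g)
    (A : V →L[ℝ] W) (hx₀ : x₀ ∈ intrinsicInterior ℝ Df)
    (hAx₀ : A x₀ ∈ intrinsicInterior ℝ Dg) :
    fenchelPrimalValue Df f Dg g A = fenchelDualValue Df f Dg g A ∧
      ∃ ys : W →L[ℝ] ℝ, -fenchelConj Df f (ys.comp A) - fenchelConj Dg g (-ys) =
        fenchelDualValue Df f Dg g A := by
  have hx₀D : x₀ ∈ Df := intrinsicInterior_subset hx₀
  have hAx₀D : A x₀ ∈ Dg := intrinsicInterior_subset hAx₀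
  have hweak := fenchel_weak_duality Df f Dg g A
  by_cases hbot : fenchelPrimalValue Df f Dg g A = ⊥
  · -- an unbounded primal problem: the dual value is `−∞` too, attained everywhere
    have hd : fenchelDualValue Df f Dg g A = ⊥ := le_bot_iff.1 (hbot ▸ hweak)
    refine ⟨hbot.trans hd.symm, 0, le_antisymm ?_ bot_le |>.trans hd.symm⟩
    · exact hd ▸ le_iSup (fun ys : W →L[ℝ] ℝ =>
        -fenchelConj Df f (ys.comp A) - fenchelConj Dg g (-ys)) 0
  · obtain ⟨-, hglb⟩ := isGLB_of_fenchelPrimalValue_ne_bot A hx₀D hAx₀D hbot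
    obtain ⟨ys, hys⟩ := decoupling_of_intrinsicInterior hf hg A hx₀ hAx₀
      (p := (fenchelPrimalValue Df f Dg g A).toReal)
      (fun x hx hAx => hglb.1 ⟨x, ⟨hx, hAx⟩, rfl⟩)
    obtain ⟨h1, h2, h3⟩ := fenchel_strong_duality_of_decoupling hglb hys
    exact ⟨h1.trans h2.symm, ys, h3.trans h2.symm⟩

/-- **Theorem 31.1 under condition (a) `ri (dom f) ∩ ri (dom g) ≠ ∅`** (both functions convex
on their domains in a finite-dimensional `V`; the book's concave `g` is `−g` here):
`inf_x {f(x) + g(x)} = sup_{x*} {−f*(x*) − g*(−x*)}`, the supremum being attained.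
[cite: Rockafellar1970, §31 Thm 31.1 (a) p. 327 (held chunk p0282)] -/
theorem iInf_add_eq_iSup_of_intrinsicInterior {Df Dg : Set V} {f g : V → ℝ} (hf : ConvexOn ℝ Df f)
    (hg : ConvexOn ℝ Dg g) (hri : (intrinsicInterior ℝ Df ∩ intrinsicInterior ℝ Dg).Nonempty) :
    ⨅ x ∈ Df ∩ Dg, ((f x + g x : ℝ) : EReal) =
        ⨆ xs : V →L[ℝ] ℝ, (-fenchelConj Df f xs - fenchelConj Dg g (-xs)) ∧
      ∃ xs : V →L[ℝ] ℝ, -fenchelConj Df f xs - fenchelConj Dg g (-xs) =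
        ⨆ xs : V →L[ℝ] ℝ, (-fenchelConj Df f xs - fenchelConj Dg g (-xs)) := by
  obtain ⟨x₀, hx₀, hx₀'⟩ := hri
  obtain ⟨hPD, ys, hys⟩ := fenchel_duality_of_intrinsicInterior hf hg
    (ContinuousLinearMap.id ℝ V) hx₀ (by simpa using hx₀')
  have hP : fenchelPrimalValue Df f Dg g (ContinuousLinearMap.id ℝ V) =
      ⨅ x ∈ Df ∩ Dg, ((f x + g x : ℝ) : EReal) := by
    simp only [fenchelPrimalValue, ContinuousLinearMap.coe_id', id_eq, sep_mem_eq]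
  have hD : fenchelDualValue Df f Dg g (ContinuousLinearMap.id ℝ V) =
      ⨆ xs : V →L[ℝ] ℝ, (-fenchelConj Df f xs - fenchelConj Dg g (-xs)) := by
    simp only [fenchelDualValue, ContinuousLinearMap.comp_id]
  refine ⟨hP ▸ hD ▸ hPD, ys, ?_⟩
  rw [ContinuousLinearMap.comp_id] at hys
  rw [hys, hD]

/-! ## §16: the conjugate of `f + gA` under the relative-interior qualification -/

/-- **Theorems 16.3/16.4 combined, with attainment, under Rockafellar's qualification** (`V`, `W`
finite-dimensional, some `x ∈ ri (dom f)` with `Ax ∈ ri (dom g)`): for every `x*` with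
`(f + gA)*(x*) < +∞` there is `y*` with `(f + gA)*(x*) = f*(x* − A*y*) + g*(y*)`, i.e.
`(f + gA)*(x*) = min_{y*} {f*(x* − A*y*) + g*(y*)}` by `DualOperations.fenchelConj_add_comp_le`.
[cite: Rockafellar1970, §16 Thms 16.3–16.4 pp. 142–146 (held chunks p0129–p0132)] -/
theorem exists_fenchelConj_add_comp_eq_of_intrinsicInterior (A : V →L[ℝ] W) (hf : ConvexOn ℝ Df f)
    (hg : ConvexOn ℝ Dg g) (hx₀ : x₀ ∈ intrinsicInterior ℝ Df)
    (hAx₀ : A x₀ ∈ intrinsicInterior ℝ Dg) {xs : V →L[ℝ] ℝ}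
    (hxs : xs ∈ fenchelDom (Df ∩ A ⁻¹' Dg) (fun x => f x + g (A x))) :
    ∃ ys : W →L[ℝ] ℝ, fenchelConj (Df ∩ A ⁻¹' Dg) (fun x => f x + g (A x)) xs =
      fenchelConj Df f (xs - ys.comp A) + fenchelConj Dg g ys := by
  have hx₀D : x₀ ∈ Df := intrinsicInterior_subset hx₀
  have hAx₀D : A x₀ ∈ Dg := intrinsicInterior_subset hAx₀
  have hne : (Df ∩ A ⁻¹' Dg).Nonempty := ⟨x₀, hx₀D, hAx₀D⟩
  -- the finite value `q = (f + gA)*(x*)`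
  set q : ℝ := (fenchelConj (Df ∩ A ⁻¹' Dg) (fun x => f x + g (A x)) xs).toReal with hq_def
  have hq : fenchelConj (Df ∩ A ⁻¹' Dg) (fun x => f x + g (A x)) xs = (q : EReal) :=
    fenchelConj_eq_coe_toReal hne hxs
  have hqle : ∀ x ∈ Df, A x ∈ Dg → xs x - (f x + g (A x)) ≤ q := fun x hx hAx => by
    have h := le_fenchelConj (f := fun x => f x + g (A x)) xs (show x ∈ Df ∩ A ⁻¹' Dg from
      ⟨hx, hAx⟩)
    rwa [hq, EReal.coe_le_coe_iff] at h
  -- decoupling for `f − x*` and `g`, lower bound `p = −q`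
  have hf' : ConvexOn ℝ Df (fun x => f x - xs x) :=
    hf.sub ((xs : V →L[ℝ] ℝ).toLinearMap.concaveOn hf.1)
  obtain ⟨ys, hys⟩ := decoupling_of_intrinsicInterior hf' hg A hx₀ hAx₀ (p := -q)
    (fun x hx hAx => by linarith [hqle x hx hAx])
  refine ⟨-ys, le_antisymm (fenchelConj_add_comp_le A xs (-ys)) ?_⟩
  rw [hq]
  refine EReal.add_le_of_forall_lt fun a' ha' b' hb' => ?_
  obtain ⟨x, hx, ha⟩ := lt_biSup_iff.1 ha'
  obtain ⟨y, hy, hb⟩ := lt_biSup_iff.1 hb'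
  have key := hys x hx y hy
  calc a' + b' ≤ (((xs - (-ys).comp A) x - f x : ℝ) : EReal) + (((-ys) y - g y : ℝ) : EReal) :=
        add_le_add ha.le hb.le
    _ ≤ (q : EReal) := by
        rw [← EReal.coe_add, EReal.coe_le_coe_iff]
        simp only [sub_apply, ContinuousLinearMap.comp_apply, neg_apply]
        linarith

/-- **Theorem 16.4, last formula with attainment (`m = 2`), under the qualification
`ri (dom f₁) ∩ ri (dom f₂) ≠ ∅`** (finite-dimensional `V`): for every `x*` with
`(f₁ + f₂)*(x*) < +∞` there are `x₁* + x₂* = x*` with `(f₁ + f₂)*(x*) = f₁*(x₁*) + f₂*(x₂*)`, i.e.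
`(f₁ + f₂)* = f₁* □ f₂*` with the infimum attained (`DualOperations.fenchelConj_add_le`).
[cite: Rockafellar1970, §16 Thm 16.4 p. 145 (held chunks p0131–p0132)] -/
theorem exists_fenchelConj_add_eq_of_intrinsicInterior {D₁ D₂ : Set V} {f₁ f₂ : V → ℝ}
    (hf₁ : ConvexOn ℝ D₁ f₁) (hf₂ : ConvexOn ℝ D₂ f₂)
    (hri : (intrinsicInterior ℝ D₁ ∩ intrinsicInterior ℝ D₂).Nonempty) {xs : V →L[ℝ] ℝ}
    (hxs : xs ∈ fenchelDom (D₁ ∩ D₂) (fun x => f₁ x + f₂ x)) :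
    ∃ xs₁ xs₂ : V →L[ℝ] ℝ, xs₁ + xs₂ = xs ∧
      fenchelConj (D₁ ∩ D₂) (fun x => f₁ x + f₂ x) xs =
        fenchelConj D₁ f₁ xs₁ + fenchelConj D₂ f₂ xs₂ := by
  obtain ⟨x₀, hx₀, hx₀'⟩ := hri
  have hxs' : xs ∈ fenchelDom (D₁ ∩ (ContinuousLinearMap.id ℝ V) ⁻¹' D₂)
      (fun x => f₁ x + f₂ ((ContinuousLinearMap.id ℝ V) x)) := by simpa using hxs
  obtain ⟨ys, hys⟩ := exists_fenchelConj_add_comp_eq_of_intrinsicInterior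
    (ContinuousLinearMap.id ℝ V) hf₁ hf₂ hx₀ (by simpa using hx₀') hxs'
  refine ⟨xs - ys, ys, sub_add_cancel xs ys, ?_⟩
  simpa using hys

/-- **Theorem 16.3, last formula with attainment, under the qualification `Ax ∈ ri (dom g)` for
some `x`** (finite-dimensional `V`, `W`): for every `x*` with `(gA)*(x*) < +∞` there is `y*` with
`A*y* = x*` and `(gA)*(x*) = g*(y*)`, i.e. `(gA)*(x*) = min {g*(y*) | A*y* = x*}`.
[cite: Rockafellar1970, §16 Thm 16.3 pp. 142–145 (held chunks p0129–p0131)] -/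
theorem exists_fenchelConj_comp_eq_of_intrinsicInterior (A : V →L[ℝ] W) (hg : ConvexOn ℝ Dg g)
    (hri : ∃ x : V, A x ∈ intrinsicInterior ℝ Dg) {xs : V →L[ℝ] ℝ}
    (hxs : xs ∈ fenchelDom (A ⁻¹' Dg) (fun x => g (A x))) :
    ∃ ys : W →L[ℝ] ℝ, ys.comp A = xs ∧ fenchelConj (A ⁻¹' Dg) (fun x => g (A x)) xs =
      fenchelConj Dg g ys := by
  obtain ⟨x₀, hAx₀⟩ := hri
  have hx₀ : x₀ ∈ intrinsicInterior ℝ (univ : Set V) := by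
    rw [intrinsicInterior_univ]; exact mem_univ _
  have hxs' : xs ∈ fenchelDom (univ ∩ A ⁻¹' Dg) (fun x => (fun _ => (0 : ℝ)) x + g (A x)) := by
    simpa using hxs
  obtain ⟨ys, hys⟩ := exists_fenchelConj_add_comp_eq_of_intrinsicInterior A
    (convexOn_const (0 : ℝ) convex_univ) hg hx₀ hAx₀ hxs'
  simp only [univ_inter, zero_add] at hys
  by_cases h0 : xs - ys.comp A = 0
  · rw [h0, fenchelConj_zero_univ_zero, zero_add] at hys
    exact ⟨ys, (sub_eq_zero.1 h0).symm, hys⟩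
  · -- `+∞ + g*(y*) = +∞` contradicts `(gA)*(x*) < +∞`
    have hb : ⊥ < fenchelConj Dg g ys :=
      bot_lt_fenchelConj ⟨A x₀, (intrinsicInterior_subset hAx₀ : A x₀ ∈ Dg)⟩ g ys
    rw [fenchelConj_zero_univ_of_ne_zero h0, EReal.top_add_of_ne_bot hb.ne'] at hys
    exact absurd hys (ne_of_lt hxs)

/-- **Corollary 16.3.1, last formula with attainment, under the qualification `Ax ∈ ri D` for
some `x`**: for every `x*` with `δ*(x* | A⁻¹D) < +∞` there is `y*` with `A*y* = x*` and
`δ*(x* | A⁻¹D) = δ*(y* | D)`. [cite: Rockafellar1970, §16 Cor 16.3.1 p. 143 (held chunk p0130)] -/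
theorem exists_supportFun_preimage_eq_of_intrinsicInterior (A : V →L[ℝ] W) {D : Set W}
    (hD : Convex ℝ D) (hri : ∃ x : V, A x ∈ intrinsicInterior ℝ D) {xs : V →L[ℝ] ℝ}
    (hxs : supportFun (A ⁻¹' D) xs < ⊤) :
    ∃ ys : W →L[ℝ] ℝ, ys.comp A = xs ∧ supportFun (A ⁻¹' D) xs = supportFun D ys := by
  have hxs' : xs ∈ fenchelDom (A ⁻¹' D) (fun x => (fun _ : W => (0 : ℝ)) (A x)) := by
    change fenchelConj _ _ _ < ⊤
    rwa [← supportFun_eq_fenchelConj]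
  obtain ⟨ys, hA, hys⟩ := exists_fenchelConj_comp_eq_of_intrinsicInterior A
    (convexOn_const (0 : ℝ) hD) hri hxs'
  exact ⟨ys, hA, by rwa [supportFun_eq_fenchelConj, supportFun_eq_fenchelConj]⟩

/-- **Corollary 16.4.1, last formula with attainment (`m = 2`), under the qualification
`ri C₁ ∩ ri C₂ ≠ ∅`**: for every `x*` with `δ*(x* | C₁ ∩ C₂) < +∞` there are `x₁* + x₂* = x*`
with `δ*(x* | C₁ ∩ C₂) = δ*(x₁* | C₁) + δ*(x₂* | C₂)` (the inequality `≤` for any split is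
`DualOperations.supportFun_inter_le`).
[cite: Rockafellar1970, §16 Cor 16.4.1 p. 146 (held chunk p0132)] -/
theorem exists_supportFun_inter_eq_of_intrinsicInterior {C₁ C₂ : Set V} (hC₁ : Convex ℝ C₁)
    (hC₂ : Convex ℝ C₂) (hri : (intrinsicInterior ℝ C₁ ∩ intrinsicInterior ℝ C₂).Nonempty)
    {xs : V →L[ℝ] ℝ} (hxs : supportFun (C₁ ∩ C₂) xs < ⊤) :
    ∃ xs₁ xs₂ : V →L[ℝ] ℝ, xs₁ + xs₂ = xs ∧
      supportFun (C₁ ∩ C₂) xs = supportFun C₁ xs₁ + supportFun C₂ xs₂ := by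
  have hxs' : xs ∈ fenchelDom (C₁ ∩ C₂) (fun x => (fun _ : V => (0 : ℝ)) x + (fun _ => 0) x) := by
    change fenchelConj _ _ _ < ⊤
    simp only [add_zero]
    rwa [← supportFun_eq_fenchelConj]
  obtain ⟨xs₁, xs₂, hsum, h⟩ := exists_fenchelConj_add_eq_of_intrinsicInterior
    (convexOn_const (0 : ℝ) hC₁) (convexOn_const (0 : ℝ) hC₂) hri hxs'
  refine ⟨xs₁, xs₂, hsum, ?_⟩
  simp only [add_zero] at h
  simpa only [supportFun_eq_fenchelConj] using h

/-! ## §23: subgradients of `f + gA` and normals to intersections -/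

/-- **Theorems 23.8/23.9 combined, under Rockafellar's qualification** (some `x ∈ ri (dom f)`
with `Ax ∈ ri (dom g)`; `V`, `W` finite-dimensional): if `x* ∈ ∂(f + gA)(x̄)`, there is
`y* ∈ ∂g(Ax̄)` with `x* − A*y* ∈ ∂f(x̄)`, i.e. `∂(f + gA)(x̄) = ∂f(x̄) + A*∂g(Ax̄)` (the
inclusion `⊇` being elementary).  (The book: `∂(f₁ + ⋯ + f_m) = ∂f₁ + ⋯ + ∂f_m` when the
`ri (dom fᵢ)` have a common point, Thm 23.8; `∂(gA)(x) = A*∂g(Ax)` when `Ax' ∈ ri (dom g)` for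
some `x'`, Thm 23.9.)
[cite: Rockafellar1970, §23 Thm 23.8 p. 223 and Thm 23.9 p. 225 (held chunks p0194–p0196)] -/
theorem subdiff_sum_rule_of_intrinsicInterior (hf : ConvexOn ℝ Df f) (hg : ConvexOn ℝ Dg g)
    (A : V →L[ℝ] W) (hx₀ : x₀ ∈ intrinsicInterior ℝ Df) (hAx₀ : A x₀ ∈ intrinsicInterior ℝ Dg)
    {x' : V} (hx' : x' ∈ Df) (hAx' : A x' ∈ Dg) {xs : V →L[ℝ] ℝ}
    (hxs : ∀ x ∈ Df, A x ∈ Dg → xs (x - x') ≤ f x + g (A x) - (f x' + g (A x'))) :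
    ∃ ys : W →L[ℝ] ℝ, (∀ y ∈ Dg, ys (y - A x') ≤ g y - g (A x')) ∧
      ∀ x ∈ Df, (xs - ys.comp A) (x - x') ≤ f x - f x' := by
  have hf' : ConvexOn ℝ Df (fun x => f x - xs x) :=
    hf.sub ((xs : V →L[ℝ] ℝ).toLinearMap.concaveOn hf.1)
  obtain ⟨ys, hys⟩ := decoupling_of_intrinsicInterior hf' hg A hx₀ hAx₀
    (p := f x' - xs x' + g (A x')) (fun x hx hAx => by
      have h := hxs x hx hAx
      rw [map_sub] at h
      linarith)
  refine ⟨-ys, fun y hy => ?_, fun x hx => ?_⟩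
  · have h := hys x' hx' y hy
    simp only [neg_apply, map_sub]
    linarith
  · have h := hys x hx (A x') hAx'
    simp only [sub_apply, ContinuousLinearMap.comp_apply, neg_apply, map_sub]
    linarith

/-- **Corollary 23.8.1 under the qualification `ri C₁ ∩ ri C₂ ≠ ∅`:** for convex `C₁`, `C₂` of a
finite-dimensional space and `x̄ ∈ C₁ ∩ C₂`, the normal cone to `C₁ ∩ C₂` at `x̄` is the sum of the
normal cones to `C₁` and to `C₂` at `x̄` (normal cones as sets of functionals
`{x* | ⟨x*, c − x̄⟩ ≤ 0 ∀ c}`). [cite: Rockafellar1970, §23 Cor 23.8.1 p. 224 (held chunk p0195)] -/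
theorem normalCone_inter_of_intrinsicInterior {C₁ C₂ : Set V} (hC₁ : Convex ℝ C₁)
    (hC₂ : Convex ℝ C₂) {x' : V} (h₁ : x' ∈ C₁) (h₂ : x' ∈ C₂)
    (hri : (intrinsicInterior ℝ C₁ ∩ intrinsicInterior ℝ C₂).Nonempty) :
    {xs : V →L[ℝ] ℝ | ∀ c ∈ C₁ ∩ C₂, xs (c - x') ≤ 0} =
      {xs : V →L[ℝ] ℝ | ∀ c ∈ C₁, xs (c - x') ≤ 0} +
        {xs : V →L[ℝ] ℝ | ∀ c ∈ C₂, xs (c - x') ≤ 0} := by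
  ext xs
  constructor
  · intro hxs
    obtain ⟨x₀, hx₀, hx₀'⟩ := hri
    obtain ⟨ys, hys, hxs'⟩ := subdiff_sum_rule_of_intrinsicInterior (convexOn_const (0 : ℝ) hC₁)
      (convexOn_const (0 : ℝ) hC₂) (ContinuousLinearMap.id ℝ V) hx₀ (by simpa using hx₀') h₁
      (by simpa using h₂) (xs := xs)
      (fun x hx hx2 => by simpa using hxs x ⟨hx, by simpa using hx2⟩)
    refine ⟨xs - ys, fun c hc => ?_, ys, fun c hc => ?_, sub_add_cancel xs ys⟩
    · simpa using hxs' c hc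
    · simpa using hys c (by simpa using hc)
  · rintro ⟨a, ha, b, hb, rfl⟩ c ⟨hc₁, hc₂⟩
    simp only [add_apply]
    linarith [ha c hc₁, hb c hc₂]

/-- **Corollary 16.4.2, second formula, under the qualification `ri K₁ ∩ ri K₂ ≠ ∅`:** for convex
cones `K₁`, `K₂` containing `0`, `(K₁ ∩ K₂)° = K₁° + K₂°` (polar cones in the dual,
`FenchelConjugate.negPolarCone`).
[cite: Rockafellar1970, §16 Cor 16.4.2 p. 146 (held chunk p0132)] -/
theorem negPolarCone_inter_of_intrinsicInterior {K₁ K₂ : Set V} (hK₁ : Convex ℝ K₁)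
    (hK₂ : Convex ℝ K₂) (h0₁ : (0 : V) ∈ K₁) (h0₂ : (0 : V) ∈ K₂)
    (hri : (intrinsicInterior ℝ K₁ ∩ intrinsicInterior ℝ K₂).Nonempty) :
    negPolarCone (K₁ ∩ K₂) = negPolarCone K₁ + negPolarCone K₂ := by
  have h := normalCone_inter_of_intrinsicInterior hK₁ hK₂ h0₁ h0₂ hri
  simp only [sub_zero] at h
  exact h

/-- **Theorem 27.4 (Pshenichnyi–Rockafellar conditions) under the qualification
`ri (dom f) ∩ ri C ≠ ∅`:** for `f` convex on `dom f`, `C` convex (finite-dimensional `V`) and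
`x̄ ∈ dom f ∩ C`, `x̄` minimises `f` over `C` iff some `x* ∈ ∂f(x̄)` has `−x*` normal to `C` at
`x̄`, i.e. `⟨x*, c − x̄⟩ ≥ 0` for every `c ∈ C`.
[cite: Rockafellar1970, §27 Thm 27.4 p. 270 (held chunk p0232)] -/
theorem isMinOn_iff_exists_subgradient_of_intrinsicInterior {Df C : Set V} {f : V → ℝ}
    (hf : ConvexOn ℝ Df f) (hC : Convex ℝ C)
    (hri : (intrinsicInterior ℝ Df ∩ intrinsicInterior ℝ C).Nonempty) {x' : V} (hx' : x' ∈ Df)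
    (hx'C : x' ∈ C) :
    IsMinOn f (Df ∩ C) x' ↔
      ∃ xs : V →L[ℝ] ℝ, (∀ y ∈ Df, xs (y - x') ≤ f y - f x') ∧ ∀ c ∈ C, 0 ≤ xs (c - x') := by
  constructor
  · intro hmin
    obtain ⟨x₀, hx₀, hx₀'⟩ := hri
    obtain ⟨ys, hys, hsub⟩ := subdiff_sum_rule_of_intrinsicInterior hf (convexOn_const (0 : ℝ) hC)
      (ContinuousLinearMap.id ℝ V) hx₀ (by simpa using hx₀') hx' (by simpa using hx'C)
      (xs := 0) (fun x hx hxC => by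
        have hle : f x' ≤ f x := hmin ⟨hx, by simpa using hxC⟩
        simp only [zero_apply]
        linarith)
    refine ⟨-ys, fun y hy => ?_, fun c hc => ?_⟩
    · have h := hsub y hy
      simp only [zero_sub, neg_apply, ContinuousLinearMap.comp_id] at h
      simpa only [neg_apply] using h
    · have h := hys c (by simpa using hc)
      simp only [ContinuousLinearMap.coe_id', id_eq, sub_self] at h
      simp only [neg_apply]
      linarith
  · rintro ⟨xs, hsub, hnormal⟩ y ⟨hy, hyC⟩
    have h1 := hsub y hy
    have h2 := hnormal y hyC
    exact sub_nonneg.1 (le_trans h2 h1) |> fun h => by simpa using h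

end Literature.Analysis.Convex.RelativeInteriorQualification
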